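import Literature.NumberTheory.LFunctions.FordProgram1Run20A
import Literature.NumberTheory.LFunctions.FordProgram1Run20B
import Literature.NumberTheory.LFunctions.FordProgram1Run20C
import HarnessLib

/-!
# Ford's "Program 1": kernel run 20 (`807 ≤ k ≤ 826`)

Topic `Literature/NumberTheory/LFunctions`. Everything here is PROVED (standard axioms):
`FordP1.checkT k = true` for `807 ≤ k ≤ 826`, i.e. the certified re-run of PROGRAM 1 of
K. Ford, Proc. LMS 85 (2002) (the second part of Theorem 3) for these `k` — see `FordProgram1.lean`
for the checker, its soundness `FordP1.row_of_checkK`, and the meaning of the constants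
(`ρ = FordP1.rhoOf k / 10⁵`, `θ = FordP1.thetaOf k / 10⁴`, `ω = FordP1.omOf k / 10⁴`).

This range was originally one monolithic kernel evaluation (`decide +kernel` on
`(List.range' 807 20).all checkT`), which exceeded the full-build resources; the kernel work now
lives in the three split files `FordProgram1Run20A.lean` (`807 ≤ k ≤ 813`), `FordProgram1Run20B.lean`
(`814 ≤ k ≤ 820`) and `FordProgram1Run20C.lean` (`821 ≤ k ≤ 826`) — one `decide +kernel` per `k` —
and this file only re-assembles the range statement `FordP1.run20` from them (no kernel evaluation
here). The assembly of all runs is `FordTheorem3SmallK.lean` (which uses `run20A/B/C` directly).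

## References

* K. Ford, Proc. London Math. Soc. (3) 85 (2002), 565–633; arXiv:1910.08209: Theorem 3, (1.7),
  Lemmas 3.4–3.5, Appendix "PROGRAM 1". [Ford2002]
-/

namespace Literature.NumberTheory.LFunctions
namespace FordP1

/-- **Kernel run 20**: `checkT k` for `807 ≤ k ≤ 826` (assembled from `run20A`, `run20B`,
`run20C`). [cite: Ford2002, Theorem 3 (second part) and PROGRAM 1] -/
theorem run20 : ((List.range' 807 20).all checkT) = true := by
  rw [List.all_eq_true]
  intro k hk
  rw [List.mem_range'_1] at hk
  obtain ⟨h1, h2⟩ := hk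
  rcases lt_or_ge k 814 with h | h
  · exact run20A k h1 (by omega)
  rcases lt_or_ge k 821 with h' | h'
  · exact run20B k h (by omega)
  · exact run20C k h' (by omega)

end FordP1
end Literature.NumberTheory.LFunctions
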